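import Mathlib
import Summits.Ventures.LatticeQCDFlow.Scaling.TruncatedJetMoments

/-!
# LatticeQCDFlow / Scaling — hypothesis (LC) REDUCED to Haar-moment identities at `β = 0`
# (item 122, part 2: the reduction for `PlaqSystem` and for the torus `torusTruncC`)

HONEST FRAMING: exact (Metropolis-corrected) sampling algorithms for lattice gauge theory;
figures of merit are autocorrelation/cost numbers at stated couplings and volumes; no
continuum-physics claim.

Custody note (lean-1 GEN-8, LEAD LINE 224 (G1)): §3–§4 of theory2's item 122 (880ddcbfd1a3f2c7 /
422 l), split at the gate's 400-line limit; §1–§2 (`mul_sub_mul_isBigO_pow`, `div_sq_sub_isBigO_pow`,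
`sum_coeff_pow_sub_isBigO`, `plaqMoment`, `plaqCoeff`, `plaqTaylor`, `numZ_sub_plaqTaylor_isBigO`) are
`Scaling/TruncatedJetMoments.lean`; declarations byte-identical.  The item's own description follows
verbatim.

# LatticeQCDFlow / Scaling — hypothesis (LC) REDUCED to Haar-moment identities at `β = 0`
# (item 122; the analytic bookkeeping between item 120's (LC) and the combinatorial census)

HONEST FRAMING: exact (Metropolis-corrected) sampling algorithms for lattice gauge theory;
figures of merit are autocorrelation/cost numbers at stated couplings and volumes; no
continuum-physics claim.

Venture `LatticeQCDFlow` (cell pub-lqcd), topic `Scaling`, item 122 of HOME/THEORY-2.md §3.1 (hy) /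
§4 row T2-AM (v4.8).  Item 120 (`Scaling.TruncatedCorrelatorFloor`) turns the leading-coefficient
hypothesis (LC) — `torusTruncC ρ (L+1) F₁ F₂ v β − b βⁿ = O(β^{n+1})` at `β = 0` with one
`b ≠ 0`, one `n`, every large `L` — into the volume-uniform floor (U′); item 121
(`Scaling.CrossCutFloorOfLeadingCoeff`) types that floor as the venture's
`Conjectures.CrossCutCorrelatorFloor`.  (LC) is a statement about a quotient of entire functions
(`PlaqSystem.expect = numZ / partZ`).  This file removes the analysis from it: (LC) follows from
FINITELY MANY IDENTITIES AMONG HAAR MOMENTS of the `β = 0` (product Haar) measure,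
`plaqMoment S F W a = ∫ F · (Σ_{p ∈ W} s_p)^a dν`, namely the vanishing of the Taylor
coefficients of `g := numZ(F₁F₂)·partZ − numZ(F₁)·numZ(F₂)` below order `n` and the value `b` at
order `n`:
* `mul_sub_mul_isBigO_pow`, `div_sq_sub_isBigO_pow` — jet algebra at `0` for functions `ℂ → ℂ`
  (product of jets; division by `Z²` with `Z(0) = 1`, `Z` differentiable at `0`);
* `numZ_sub_plaqTaylor_isBigO` — Taylor's theorem with remainder for
  `numZ F W β = ∫ F exp(−β Σ_{p∈W} s_p) dν` (`PlaqSystem.numZ_eq_integral_exp`): for `F` bounded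
  measurable, `numZ F W β − Σ_{a ≤ n} ((−1)^a/a!) plaqMoment_a βᵃ = O(β^{n+1})` (pointwise
  `‖exp x − Σ_{a ≤ n} xᵃ/a!‖ ≤ ‖x‖^{n+1} e^{‖x‖}`, `Complex.norm_exp_sub_sum_le_norm_mul_exp`,
  integrated against the probability measure `zdHaar`);
* `sum_coeff_pow_sub_isBigO` — a product of two Taylor polynomials whose convolved coefficients
  vanish below order `n` and equal `b` at order `n` is `b βⁿ + O(β^{n+1})`;
* `PlaqSystem.truncated_leadingCoeff_of_moments` (division step over the tree's
  `PlaqSystem.expect_mul_sub_eq_div`, `PlaqSystem.partZ_zero`,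
  `PlaqSystem.differentiable_numZ/partZ`) — for a regular plaquette system `S`, a finite
  label set `W` and bounded measurable `F₁, F₂`: IF for every `k ≤ n`
  `Σ_{a+c=k} (plaqCoeff (F₁F₂) a · plaqCoeff 1 c − plaqCoeff F₁ a · plaqCoeff F₂ c) = b·[k = n]`
  (`plaqCoeff F a := (−1)^a/a! · plaqMoment F a`), THEN
  `⟨F₁F₂⟩_W(β) − ⟨F₁⟩_W(β)⟨F₂⟩_W(β) − b βⁿ = O(β^{n+1})` at `β = 0`;
* `torusTruncC_leadingCoeff_of_moments` — the same for item 120's `torusTruncC ρ L' F₁ F₂ x`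
  (the torus plaquette system `torusSystem ρ L'`, labels `torusGenuine d L'`, observables read
  through `torusRed L'`): hypothesis (LC) of items 120/121 ⇐ the moment identities (MI).
CONSEQUENCE: the successor's target (LC) (HOME/lean/theory2/LANDING.md §32–§33: two parallel
plaquettes at distance `t = 2R+1`, `n = 4t`, `b = 2^{-(4t+1)} N^{-4t}` for `U(1)` / `SU(N)`,
`N ≥ 3`) is now the purely combinatorial census (MI) of Haar integrals
`∫ P₀ (P₀∘θ_v) (Σ_p s_p)^a dν`, `∫ P₀ (Σ_p s_p)^a dν`, `∫ (Σ_p s_p)^a dν`,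
`a ≤ 4t`, on the torus of side `L+1 ≥ L₀` (`v = t·e_a`; `P₀∘θ_v` is the plaquette at `−v`) —
the free-bond lemma (a bond covered by exactly one plaquette character integrates to zero) and
the count of the minimal tube [cite: MontvayMunster1994, §3.6.2 eq. (3.437)],
[cite: Schor1984, Thm 3.1–3.2]; no holomorphy, no quotients, no `O`-constants.
LITERATURE GRADE (honest): textbook mechanism (strong-coupling / high-temperature expansion of a
truncated correlation = expansion of numerator and denominator at `β = 0`
[cite: SeilerLNP1982, Ch. 2–3]); new = kernel-checked, for the tree's abstract `PlaqSystem` and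
its torus instance, with the exact interface (MI) the census must meet.

References: E. Seiler, LNP 159 (1982) Ch. 2–3 [SeilerLNP1982]; K. Osterwalder, E. Seiler, Ann.
Phys. 110 (1978) 440, §3 [OsterwalderSeilerAnnPhys1978]; I. Montvay, G. Münster, *Quantum Fields
on a Lattice* (1994) §3.6.2 [MontvayMunster1994]; R. Schor, Commun. Math. Phys. 92 (1984) 369–395
[Schor1984].  Elementary given the tree; farm `lean check` rc 0, no `sorry`.
-/

noncomputable section

open MeasureTheory Filter Asymptotics Finset
open scoped Topology Nat
open Literature.MathematicalPhysics.QuantumFieldTheory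
open Literature.MathematicalPhysics.QuantumLattice (configShift)

namespace Summit.Ventures.LatticeQCDFlow.Theory2

/-! ## 3. (LC) from the moment identities (MI) -/

section Reduction

variable {d : ℕ} {G : Type*} {ι : Type*} [Group G] [TopologicalSpace G] [IsTopologicalGroup G]
  [CompactSpace G] [MeasurableSpace G] [BorelSpace G] {S : PlaqSystem d G ι} {M : ℝ} {D : ℕ}

/-- **(LC) ⇐ (MI) for an abstract plaquette system.**  `S` regular, `W` a finite label set,
`F₁, F₂` bounded measurable.  IF the convolved Taylor coefficients of
`numZ(F₁F₂)·partZ − numZ(F₁)·numZ(F₂)` vanish below order `n` and equal `b` at order `n` —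
`Σ_{a+c=k} (plaqCoeff (F₁F₂) a · plaqCoeff 1 c − plaqCoeff F₁ a · plaqCoeff F₂ c) = b·[k = n]`
for all `k ≤ n` (finitely many identities among Haar moments at `β = 0`) — THEN the truncated
expectation has leading term `b βⁿ`:
`⟨F₁F₂⟩_W(β) − ⟨F₁⟩_W(β)⟨F₂⟩_W(β) − b βⁿ = O(β^{n+1})` at `β = 0`. [folklore] -/
theorem PlaqSystem.truncated_leadingCoeff_of_moments [DecidableEq ι] (hR : S.Regular M D)
    {F₁ F₂ : ZdGaugeConfig d G → ℂ} (h₁m : Measurable F₁) (h₂m : Measurable F₂) {C₁ C₂ : ℝ}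
    (h₁b : ∀ U, ‖F₁ U‖ ≤ C₁) (h₂b : ∀ U, ‖F₂ U‖ ≤ C₂) (W : Finset ι) {n : ℕ} {b : ℂ}
    (hMI : ∀ k ≤ n, ∑ ac ∈ antidiagonal k,
      (plaqCoeff S (fun U => F₁ U * F₂ U) W ac.1 * plaqCoeff S (fun _ => 1) W ac.2 -
        plaqCoeff S F₁ W ac.1 * plaqCoeff S F₂ W ac.2) = if k = n then b else 0) :
    (fun β => (S.expect (fun U => F₁ U * F₂ U) W β - S.expect F₁ W β * S.expect F₂ W β) -
      b * β ^ n) =O[𝓝 (0 : ℂ)] fun β => β ^ (n + 1) := by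
  have hC₁0 : 0 ≤ C₁ := (norm_nonneg _).trans (h₁b fun _ => 1)
  have h12m : Measurable fun U => F₁ U * F₂ U := h₁m.mul h₂m
  have h12b : ∀ U, ‖F₁ U * F₂ U‖ ≤ C₁ * C₂ := fun U => by
    rw [norm_mul]; exact mul_le_mul (h₁b U) (h₂b U) (norm_nonneg _) hC₁0
  have h1b' : ∀ U : ZdGaugeConfig d G, ‖(fun _ => (1 : ℂ)) U‖ ≤ 1 := fun U => by simp
  -- Taylor expansions of the four entire functions
  have e12 := numZ_sub_plaqTaylor_isBigO hR h12m h12b W n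
  have e1 := numZ_sub_plaqTaylor_isBigO hR h₁m h₁b W n
  have e2 := numZ_sub_plaqTaylor_isBigO hR h₂m h₂b W n
  have eZ := numZ_sub_plaqTaylor_isBigO hR measurable_const h1b' W n
  -- boundedness near `0`
  have bdd_numZ : ∀ {F : ZdGaugeConfig d G → ℂ}, Measurable F → ∀ {C : ℝ}, (∀ U, ‖F U‖ ≤ C) →
      S.numZ F W =O[𝓝 (0 : ℂ)] fun _ => (1 : ℂ) := by
    intro F hFm C hFb
    exact ((S.differentiable_numZ hR hFm hFb W).continuous.tendsto 0).isBigO_one ℂ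
  have bdd_taylor : ∀ F : ZdGaugeConfig d G → ℂ,
      plaqTaylor S F W n =O[𝓝 (0 : ℂ)] fun _ => (1 : ℂ) := fun F => by
    have hc : Continuous (plaqTaylor S F W n) := by
      unfold plaqTaylor; fun_prop
    exact (hc.tendsto 0).isBigO_one ℂ
  -- the numerator `g = N₁₂ Z − N₁ N₂` and its Taylor polynomial
  have hg : (fun β => (S.numZ (fun U => F₁ U * F₂ U) W β * S.partZ W β -
      S.numZ F₁ W β * S.numZ F₂ W β) -
      (plaqTaylor S (fun U => F₁ U * F₂ U) W n β * plaqTaylor S (fun _ => 1) W n β -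
        plaqTaylor S F₁ W n β * plaqTaylor S F₂ W n β)) =O[𝓝 (0 : ℂ)] fun β => β ^ (n + 1) := by
    have hA := mul_sub_mul_isBigO_pow e12 eZ (bdd_numZ h12m h12b) (bdd_taylor _)
    have hB := mul_sub_mul_isBigO_pow e1 e2 (bdd_numZ h₁m h₁b) (bdd_taylor _)
    exact (hA.sub hB).congr_left fun β => by simp only [PlaqSystem.partZ]; ring
  -- the Taylor polynomial of `g` is `b βⁿ + O(β^{n+1})`
  have hexp : ∀ β : ℂ, plaqTaylor S (fun U => F₁ U * F₂ U) W n β * plaqTaylor S (fun _ => 1) W n β -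
      plaqTaylor S F₁ W n β * plaqTaylor S F₂ W n β =
      ∑ a ∈ range (n + 1), ∑ c ∈ range (n + 1),
        (plaqCoeff S (fun U => F₁ U * F₂ U) W a * plaqCoeff S (fun _ => 1) W c -
          plaqCoeff S F₁ W a * plaqCoeff S F₂ W c) * β ^ (a + c) := by
    intro β
    simp only [plaqTaylor, Finset.sum_mul_sum, ← Finset.sum_sub_distrib]
    refine sum_congr rfl fun a _ => sum_congr rfl fun c _ => ?_
    rw [pow_add]; ring
  have hpoly : (fun β => (plaqTaylor S (fun U => F₁ U * F₂ U) W n β *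
      plaqTaylor S (fun _ => 1) W n β - plaqTaylor S F₁ W n β * plaqTaylor S F₂ W n β) -
      b * β ^ n) =O[𝓝 (0 : ℂ)] fun β => β ^ (n + 1) := by
    refine (sum_coeff_pow_sub_isBigO (e := fun a c =>
      plaqCoeff S (fun U => F₁ U * F₂ U) W a * plaqCoeff S (fun _ => 1) W c -
        plaqCoeff S F₁ W a * plaqCoeff S F₂ W c) hMI).congr_left fun β => ?_
    rw [hexp β]
  have hgb : (fun β => (S.numZ (fun U => F₁ U * F₂ U) W β * S.partZ W β -
      S.numZ F₁ W β * S.numZ F₂ W β) - b * β ^ n) =O[𝓝 (0 : ℂ)] fun β => β ^ (n + 1) :=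
    (hg.add hpoly).congr_left fun β => by ring
  -- divide by `Z²`
  have hZd : DifferentiableAt ℂ (S.partZ W) 0 := (S.differentiable_partZ hR W) 0
  have hdiv := div_sq_sub_isBigO_pow hgb hZd (S.partZ_zero W)
  refine hdiv.congr_left fun β => ?_
  rcases eq_or_ne (S.partZ W β) 0 with hz | hz
  · simp [PlaqSystem.expect, hz]
  · rw [S.expect_mul_sub_eq_div W hz]
    ring

end Reduction

/-! ## 4. The torus: hypothesis (LC) of items 120–121 from the moment identities -/

section Torus

variable {d N : ℕ} {G : Type} [Group G] [TopologicalSpace G] [IsTopologicalGroup G]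
  [CompactSpace G] [MeasurableSpace G] [BorelSpace G] (ρ : G →* Matrix (Fin N) (Fin N) ℂ)

/-- **(LC) ⇐ (MI) on the torus.**  For the torus Wilson system of side `L'` (`torusSystem ρ L'`,
labels `torusGenuine d L'`, costs `s_p(U) = N − Re tr ρ(U_p)` read through `torusRed L'`) and two
bounded measurable observables `F₁`, `F₂ ∘ configShift x` of the infinite lattice: IF the moment
identities (MI) hold to order `n` with value `b`, THEN item 120's complex truncated torus
expectation satisfies `torusTruncC ρ L' F₁ F₂ x β − b βⁿ = O(β^{n+1})` at `β = 0` — hypothesis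
(LC) of `torus_truncated_floor_of_leadingCoeff` / `crossCutCorrelatorFloor_of_leadingCoeff` for
this `L'`. [folklore] -/
theorem torusTruncC_leadingCoeff_of_moments (hρ : Continuous ρ) (L' : ℕ) [NeZero L']
    {F₁ F₂ : ZdGaugeConfig d G → ℝ} (h₁m : Measurable F₁) (h₂m : Measurable F₂) {C₁ C₂ : ℝ}
    (h₁b : ∀ U, |F₁ U| ≤ C₁) (h₂b : ∀ U, |F₂ U| ≤ C₂)
    (x : Literature.Probability.LatticeModels.Site d) {n : ℕ} {b : ℂ}
    (hMI : ∀ k ≤ n, ∑ ac ∈ antidiagonal k,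
      (plaqCoeff (torusSystem ρ L') (fun U => (F₁ (U ∘ torusRed L') : ℂ) *
            (F₂ (configShift x (U ∘ torusRed L')) : ℂ)) (torusGenuine d L') ac.1 *
          plaqCoeff (torusSystem ρ L') (fun _ => 1) (torusGenuine d L') ac.2 -
        plaqCoeff (torusSystem ρ L') (fun U => (F₁ (U ∘ torusRed L') : ℂ)) (torusGenuine d L')
            ac.1 *
          plaqCoeff (torusSystem ρ L') (fun U => (F₂ (configShift x (U ∘ torusRed L')) : ℂ))
            (torusGenuine d L') ac.2) = if k = n then b else 0) :
    (fun β : ℂ => torusTruncC ρ L' F₁ F₂ x β - b * β ^ n) =O[𝓝 (0 : ℂ)] fun β => β ^ (n + 1) := by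
  classical
  have hReg : (torusSystem (d := d) (G := G) ρ L').Regular (costBound ρ) (Plaq.degBound d) :=
    torusSystem_regular ρ hρ
  have hΦ₁m : Measurable fun U : ZdGaugeConfig d G => (F₁ (U ∘ torusRed L') : ℂ) :=
    Complex.measurable_ofReal.comp (h₁m.comp (measurable_comp_relabel (torusRed L')))
  have hΦ₂m : Measurable fun U : ZdGaugeConfig d G => (F₂ (configShift x (U ∘ torusRed L')) : ℂ) :=
    Complex.measurable_ofReal.comp ((h₂m.comp (configShift x).measurable).comp
      (measurable_comp_relabel (torusRed L')))
  have hΦ₁b : ∀ U : ZdGaugeConfig d G, ‖(F₁ (U ∘ torusRed L') : ℂ)‖ ≤ C₁ := fun U => by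
    rw [Complex.norm_real, Real.norm_eq_abs]; exact h₁b _
  have hΦ₂b : ∀ U : ZdGaugeConfig d G, ‖(F₂ (configShift x (U ∘ torusRed L')) : ℂ)‖ ≤ C₂ :=
    fun U => by rw [Complex.norm_real, Real.norm_eq_abs]; exact h₂b _
  exact PlaqSystem.truncated_leadingCoeff_of_moments hReg hΦ₁m hΦ₂m hΦ₁b hΦ₂b
    (torusGenuine d L') hMI

end Torus

end Summit.Ventures.LatticeQCDFlow.Theory2

end
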